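import Literature.AlgebraicGeometry.HodgeTheory.BettiUniverseAxioms

/-!
# Odd-degree cup products are alternating (Betti universe)

For a `ℂ`-scheme `X` and an odd degree `k`, the cup product
`Hᵏ(X(ℂ); ℚ) × Hᵏ(X(ℂ); ℚ) → H²ᵏ(X(ℂ); ℚ)` is anticommutative, hence alternating in characteristic
`0`; consequently every pairing `(x, y) ↦ φ (x ∪ y)` (in particular the intersection form
`(x, y) ↦ tr (x ∪ y)` on the middle cohomology of an odd-dimensional smooth projective variety) is
an alternating bilinear form. This is the `IsAlt` input of the symplectic linear algebra used on
`H³` of threefolds (routes `SignSymmetricPowers`, `CyclicUnitaryPowers` of the Hodge summit: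
`Literature.LinearAlgebra.Alternating.SymplecticInvolutionCentralizer.mem_of_forall_commutator_mem`,
`Summit.HodgeConjecture.HodgeConjecture.Theorems.SignCommutatorDegreeTwoCore`).
Source: graded commutativity of the cup product, Hatcher, *Algebraic Topology*, §3.2 Thm. 3.11
(the tree's `cupProduct_gradedComm_holds`, as in `BettiUniverse.cup_comm_one`).
-/

namespace Literature.AlgebraicGeometry.HodgeTheory.BettiUniverse

open Literature.AlgebraicTopology.SingularHomology (cupProduct_gradedComm_holds)
open Literature.AlgebraicGeometry.Motives (bettiCohomology)

variable {X : Motives.SchemeOver ℂ}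

/-- **Anticommutativity in odd degree**: `a ∪ b = -(b ∪ a)` for `a, b ∈ Hᵏ(X(ℂ); ℚ)`, `k` odd
(graded commutativity, sign `(-1)^{k·k} = -1`). [cite: HatcherAT2002, §3.2 Thm. 3.11] -/
theorem cup_comm_of_odd {k : ℕ} (hk : Odd k) (a b : bettiCohomology X k) :
    cup X k k a b = -(cup X k k b a) := by
  have h := Motives.bettiCup_gradedComm
    (cupProduct_gradedComm_holds ℚ (Motives.ComplexPoints X)) (rfl : k + k = k + k) rfl a b
  have hodd : Odd (k * k) := hk.mul hk
  rw [h, hodd.neg_one_pow, neg_one_smul]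

/-- **Odd-degree cup squares vanish rationally**: `a ∪ a = 0` for `a ∈ Hᵏ(X(ℂ); ℚ)`, `k` odd.
[cite: HatcherAT2002, §3.2 Thm. 3.11] -/
theorem cup_self_of_odd {k : ℕ} (hk : Odd k) (a : bettiCohomology X k) : cup X k k a a = 0 := by
  have h := cup_comm_of_odd hk a a
  have h2 : (2 : ℚ) • cup X k k a a = 0 := by rw [two_smul]; nth_rw 1 [h]; exact neg_add_cancel _
  exact (smul_eq_zero.mp h2).resolve_left two_ne_zero

/-- The odd-degree cup product `Hᵏ ⊗ Hᵏ → H²ᵏ` is an alternating bilinear map.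
[cite: HatcherAT2002, §3.2 Thm. 3.11] -/
theorem isAlt_cup_of_odd {k : ℕ} (hk : Odd k) : (cup X k k).IsAlt :=
  fun a => cup_self_of_odd hk a

/-- Every pairing `(x, y) ↦ φ (x ∪ y)` through the odd-degree cup product is alternating; with
`φ = tr hX (k + k)` this is the intersection form on the middle cohomology of an odd-dimensional
smooth projective variety. [cite: HatcherAT2002, §3.2 Thm. 3.11] -/
theorem isAlt_cup_compr₂_of_odd {k : ℕ} (hk : Odd k) {N : Type*} [AddCommGroup N] [Module ℚ N]
    (φ : bettiCohomology X (k + k) →ₗ[ℚ] N) : ((cup X k k).compr₂ φ).IsAlt := by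
  intro a
  rw [LinearMap.compr₂_apply, cup_self_of_odd hk a, map_zero]

/-- The intersection form `(x, y) ↦ tr (x ∪ y)` on `Hᵏ(X(ℂ); ℚ)`, `k` odd, of a smooth projective
`X` is an alternating bilinear form (as a `LinearMap.BilinForm ℚ`). [cite: HatcherAT2002, §3.2 Thm. 3.11] -/
theorem isAlt_tr_cup_of_odd {n k : ℕ} (hX : Motives.IsSmoothProjective n X) (hk : Odd k) :
    (((cup X k k).compr₂ (tr hX (k + k))) : LinearMap.BilinForm ℚ (bettiCohomology X k)).IsAlt :=
  isAlt_cup_compr₂_of_odd hk (tr hX (k + k))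

end Literature.AlgebraicGeometry.HodgeTheory.BettiUniverse
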